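import Literature.Topology.FourManifolds.OneManifoldCompatibleCover
import Literature.Topology.FourManifolds.SmoothOrientationGluing
import HarnessLib

/-!
# Every `1`-manifold is orientable

Topic `Literature/Topology/FourManifolds`, sequel to `OneManifoldOrientable.lean` (compact
connected case) and `OneManifoldCompatibleCover.lean` (connected case,
`OneManifold.isOrientable_of_connectedSpace`): the connectedness hypothesis is removed.

* `OneManifold.isOrientable` (**every Hausdorff second countable `1`-manifold is orientable**):
  orientations form a sheaf (`SmoothOrientation.eventually_eq_iff_of_opens`,
  `SmoothOrientationGluing.lean`: local constancy is a local condition and the charts of an open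
  submanifold are the restricted charts), and the connected components of a manifold are open
  submanifolds, each a connected Hausdorff second countable `1`-manifold, hence orientable; an
  orientation chosen on each component (indexed by the component as an open set, so that the
  choice is the same at all of its points) defines an orientation of `M`.

Milnor (*Topology from the Differentiable Viewpoint* (1965), Appendix) and Hirsch
(*Differential Topology* (1976), Ch. 1 §2 Exercise 6, §4.4) obtain orientability of
`1`-manifolds as a by-product of the classification. All statements here are **proved**; no
definitions or named facts are introduced.

## References

* J. Milnor, *Topology from the Differentiable Viewpoint*, Univ. Press of Virginia (1965),
  Appendix "Classifying 1-manifolds", pp. 55–57. [MilnorTDV1965]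
* M. W. Hirsch, *Differential Topology*, GTM 33 (1976), Ch. 1 §2 Exercise 6; §4.4.
  [HirschDT1976]
-/

open Set Filter Topology
open scoped Manifold ContDiff

noncomputable section

namespace Literature.Topology.FourManifolds

namespace OneManifold

/-- **Every Hausdorff second countable `1`-manifold is orientable.** A Hausdorff second
countable `C^∞` manifold modelled on `EuclideanSpace ℝ (Fin 1)` admits a `SmoothOrientation`:
each connected component is an open submanifold (a manifold is locally connected) which is a
connected Hausdorff second countable `1`-manifold, hence orientable
(`isOrientable_of_connectedSpace`, Milnor's classification, topological content); choose an
orientation of each component — as a function of the component *qua* open subset, so that all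
points of a component see the same choice — and evaluate it at the point; local constancy on
`M` is local constancy on the component through the point
(`SmoothOrientation.eventually_eq_iff_of_opens`: the charts of an open submanifold are the
restricted charts). Hirsch, *Differential Topology* (1976), §4.4 (orientations as a sheaf);
Milnor (1965), Appendix. [cite: HirschDT1976, §4.4] -/
theorem isOrientable {M : Type*} [TopologicalSpace M] [ChartedSpace (EuclideanSpace ℝ (Fin 1)) M]
    [IsManifold (𝓡 1) ∞ M] [T2Space M] [SecondCountableTopology M] : IsOrientable (𝓡 1) M := by
  classical
  haveI : LocallyConnectedSpace M :=
    ChartedSpace.locallyConnectedSpace (EuclideanSpace ℝ (Fin 1)) M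
  -- an orientation of every connected open subset, chosen once per subset
  have ho : ∀ U : TopologicalSpace.Opens M, IsConnected (U : Set M) →
      Nonempty (SmoothOrientation (𝓡 1) U) := fun U hU => by
    haveI : ConnectedSpace U := isConnected_iff_connectedSpace.1 hU
    exact isOrientable_of_connectedSpace (M := U)
  let o : ∀ U : TopologicalSpace.Opens M, IsConnected (U : Set M) → SmoothOrientation (𝓡 1) U :=
    fun U hU => Classical.choice (ho U hU)
  -- re-indexing along an equality of open subsets
  have key : ∀ (U V : TopologicalSpace.Opens M) (_ : U = V) (hU : IsConnected (U : Set M))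
      (hV : IsConnected (V : Set M)) (z : M) (hzU : z ∈ U) (hzV : z ∈ V),
      o U hU ⟨z, hzU⟩ = o V hV ⟨z, hzV⟩ := by
    rintro U V rfl hU hV z hzU hzV
    rfl
  -- the component of a point as an open subset
  set C : M → TopologicalSpace.Opens M := fun x => ⟨connectedComponent x, isOpen_connectedComponent⟩
    with hC_def
  have hCconn : ∀ x, IsConnected (C x : Set M) := fun x => isConnected_connectedComponent
  have hCmem : ∀ x, x ∈ C x := fun x => mem_connectedComponent
  have hCeq : ∀ {x y : M}, y ∈ C x → C y = C x := fun {x y} hy =>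
    TopologicalSpace.Opens.ext (connectedComponent_eq hy).symm
  refine ⟨{ toFun := fun x => o (C x) (hCconn x) ⟨x, hCmem x⟩
            eventually_eq_iff' := fun x => ?_ }⟩
  exact SmoothOrientation.eventually_eq_iff_of_opens _ (C x) (o (C x) (hCconn x))
    (fun y hy => key (C y) (C x) (hCeq hy) (hCconn y) (hCconn x) y (hCmem y) hy) (hCmem x)

end OneManifold

end Literature.Topology.FourManifolds
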